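/-
Origin: expansion seat `planner-pub-hodgecm-mc-axioms-1-g16-0`, handover #7 2026-08-20T23:46Z md5 3b67c350f8d8 (NEW; 213 l.; imports `HodgeCM.Model.LiuDictionaryInstance` + `HodgeCM.Vendored.H21.NumberTheory.GelbartRogawski1991.UnitaryDualPairThetaKernelTwist`; ns `HodgeCM.Model` (§0) ∕ `HodgeCM.Model.SplitLine` (§1); KERNEL: §0 two orbit laws of the vendored splitting-level twist `Weil1964.adelicMpCont.twist` (generic `{F} {ι} {T} {H} [Group H]`): `adelicMpCont_twist_one : twist F ι T s 1 = s` (:= `MonoidHom.ext` of vendored `twist_eq_of_eq_one`), `adelicMpCont_twist_twist : twist (twist s η₁) η₂ = twist s (η₁ * η₂)` (term-mode chain over vendored `twist_apply`, `map_mul ofScalar`, `mul_comm` in ℂˣ); §1 on the index record `p : SplitLine JV TV hcδ hδ hd hV hVd hJV` of #4r3 (N = 3, M = 1, L⁺ = `maximalRealSubfield L`, conj = `IsCMField.complexConj L`): `abbrev SplitLine.BigChar p := ↥(UnitaryGroup.adelicPair L⁺ L conj 3 1 JV p.JW) →* ℂˣ` (characters of G₁(𝔸_{L⁺}) = U(J_V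 ⊗ J_W)(𝔸) — the DOMAIN of `p.s`, theta-3 (W1)), `abbrev SplitLine.RatPair p := ↥(UnitaryGroup.rationalPair … 3 1 JV p.JW)` (G₁(L⁺)), `def SplitLine.finPairCharOf p ĉ : ↥(finAdelic … 3 JV) × ↥(finAdelic … 1 p.JW) →* ℂˣ := (ĉ.comp (UnitaryDualPair.pairMap …)).comp (HodgeCM.WeilCoinv.finPairToAdelic …)` (ĉ_f) + `finPairCharOf_apply` (rfl), `abbrev SplitLine.IsRatTrivial p ĉ : Prop := ∀ γ₀ : p.RatPair, ĉ (UnitaryGroup.rationalPairToAdelic … γ₀) = 1` + `IsRatTrivial.one` ∕ `IsRatTrivial.mul`, `SplitLine.ratTrivial : p.IsRatTrivial ĉ → ∀ γ ∈ (splittingDatum L⁺ L conj 3 1 p.e JV p.JW hcδ hδ hd hV p.hW hVd p.hWd hJV p.hJW).ratPts, ĉ γ = 1` (vendored `splittingDatum_ratPts` rfl), **`def SplitLine.twistBy (p) (ĉ : p.BigChar) (hĉ : p.IsRatTrivial ĉ) : SplitLine JV TV hcδ hδ hd hV hVd hJV := { toHermLineDatum := p.toHermLineDatum, s := adelicMpCont.twist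 L⁺ (Fin p.n) (adelicGram L⁺ p.e TV p.TW) p.s ĉ, hs := UnitaryDualPair.isCompatible_twist … p.hs (p.ratTrivial ĉ hĉ) }`** (the compatibility of the twist = the vendored KERNEL theorem `UnitaryDualPairThetaKernelTwist` :114, from `SplittingDatum.IsCompatible.of_central_twist`; [GelbartRogawski1991 §3.1 Remark p. 457 L4–13]: every compatible splitting is such a twist), `twistBy_toHermLineDatum` (simp, rfl) ∕ `twistBy_JW` ∕ `twistBy_s` ∕ `twistBy_charW : (p.twistBy ĉ hĉ).CharW = p.CharW` (rfl — SAME LINE, same characters, same `Ω`-shape: `example : Module (adelicAlgebra V) ((p.twistBy ĉ hĉ).Ω ιV χ) := inferInstance`), `pairSplitting_twistBy_apply : pairSplitting … (p.twistBy ĉ hĉ).s g = ofScalar … (ĉ (pairMap … g)) * pairSplitting … p.s g` (vendored `pairSplitting_twist_apply`), **`pairRep_twistBy_apply : pairRep L⁺ L conj 3 1 p.e JV p.JW (p.twistBy ĉ hĉ).s g Φ = ((ĉ (pairMap … g) : ℂˣ) : ℂ) • pairRep … p.s g Φ`** (the adèlic scalar law `ω((p ⊗ ĉ).s_pair(g))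 = ĉ(g_V g_W) · ω(p.s_pair(g))`, vendored `pairRep_twist_apply`), orbit laws **`twistBy_one : p.twistBy 1 h = p`** and **`twistBy_twistBy : (p.twistBy ĉ₁ h₁).twistBy ĉ₂ h₂ = p.twistBy (ĉ₁ * ĉ₂) (h₁.mul h₂)`** (the compatible splittings of the record's line form a torsor under the rationally trivial big characters). CERT lean-direct (1 process, nice 19, elan 4.32.0, `-DautoImplicit=false`) over the post-GO #2₆₆ PKG oleans (lane idle, result l.59): rc 0 ∕ 21 s ∕ 0 warn ∕ 0 proof holes `farm/logs/j3tw-5.log` (+ `-o` build `j3tw-6o.log` rc 0); `#print axioms` 19 ∕ 19 ⊆ {propext, Classical.choice, Quot.sound}, `proof-holeAx` 0 `farm/logs/j3tw-axioms.log` bb364cb8f694; placeholder-token grep 0; source `lean/J3tw/src/`; NAME LIST (theorems, for the audited segment): `HodgeCM.Model.SplitLine.pairRep_twistBy_apply` · `HodgeCM.Model.SplitLine.twistBy_twistBy` · `HodgeCM.Model.adelicMpCont_twist_twist`) (`HOME/mc/pub-hodgecm-mc-axioms-1-g16/stage67/HodgeCM/Model/LiuDictionaryInstanceTwist.lean`,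 md5 3b67c350f8d8, 213 lines);
landed by the gen-28 packager (p-g28) in gate run 67 as `HodgeCM/Model/LiuDictionaryInstanceTwist.lean` (verbatim).
-/
/-
unit pub-hodgecm-mc-axioms-1-g16 (gen 16), seat planner-pub-hodgecm-mc-axioms-1-g16-0, 2026-08-20.
(J3) DATUM SEAM 2, option (C) «TWIST THE SPLITTING, NOT THE DICTIONARY» (STATUS l.14690; sinst-1-g10 AGREED l.14692,
theta-3-g27 l.14701 no objection + (W1) typing): the see-saw normalisation of the honest theta datum enters the adèlic INDEX
RECORD `SplitLine` (axioms-1 #4, RUN 64) as a central twist of its compatible pair splitting, never the dictionary's carriers.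
RECORD LEVEL ONLY (leaf r1): the representation-level twist API (`finPairRep_twist`, `weilCoinvTwistEquiv`, …) is #S14 r3's
(theta-3-g27, `HodgeCM.WeilCoinv`); its record-level corollaries follow in a second leaf.  KERNEL definitions and theorems only:
no record, no cited sentence; E / row 9 / MODEL-N untouched; nothing imports this file.
-/
import Summits.HodgeConjecture.HodgeCM.Model.LiuDictionaryInstance
import Literature.NumberTheory.GelbartRogawski1991.UnitaryDualPairThetaKernelTwist

-- G11b-3 recipe (port D30 slow-export class; ops-buildfix LEDGER B13-1/B13-3): elaborate sequentially so the trailing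
-- `attribute [implicit_reducible]` block (reducibilityCoreExt is keyed to the async environment branch) is in force at `.olean` export.
set_option Elab.async false

/-!
# (J3) Central twists of the index record: `SplitLine.twistBy`

[GelbartRogawski1991, §3.1 Remark p. 457 L4–13]: the compatible splittings `s` of the metaplectic cover over
`G₁(𝔸_F) = U(J_V ⊗ J_W)(𝔸_F)` form ONE orbit under `s ↦ s ⊗ ν′`, `ν′` an automorphic character of `G₁(𝔸_F)` with values in the
central `ℂˣ`.  In the tree the splitting-level twist is `Weil1964.adelicMpCont.twist s ĉ` (`(s ⊗ ĉ)(h) = (1, ĉ(h)) · s(h)`,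
`ω_ψ((s ⊗ ĉ)(h)) = ĉ(h) · ω_ψ(s(h))` = `omega_twist`), and «`s` compatible and `ĉ|_{G₁(F)} = 1` ⇒ `s ⊗ ĉ` compatible» is the vendored
KERNEL theorem `GelbartRogawski1991.UnitaryDualPair.isCompatible_twist` (from `SplittingDatum.IsCompatible.of_central_twist`).
Varying the splitting `p.s` of an index record `p : SplitLine …` over that orbit is varying Liu's `μ` in `ω(μ, ε, χ)` ([Liu21] App. D
Step 2), so a twisted record is again an honest index of `liuDictionaryOfWeil` / `liuDictionaryOfWeilFamily`, and the dictionary's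
carrier stays `Ω(p, χ) = weilCoinv χ p.s` VERBATIM — the see-saw normalisation is read in the INDEX, where K0 reads it.

Contents (`N = 3`, `M = 1`; namespace `HodgeCM.Model.SplitLine`): `BigChar p` (characters `ĉ` of `G₁(𝔸_{L⁺})` — the domain of
`p.s`; a character of the member product `U(J_V)(𝔸) × U(J_W)(𝔸)` enters only through `noncommCoprod adelicInl adelicInr` under the
centre condition, theta-3 (W1)), `RatPair p` (`G₁(L⁺)`), `finPairCharOf p ĉ = ĉ_f` (the restriction to `U(J_V)(𝔸_f) × U(J_W)(𝔸_f)`),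
`IsRatTrivial p ĉ` («`ĉ|_{G₁(L⁺)} = 1`») with `ratTrivial` (the datum's form) and its `one`/`mul` closure, **`twistBy p ĉ hĉ`**
(same hermitian line, splitting `p.s ⊗ ĉ`) with `twistBy_toHermLineDatum`, `twistBy_JW`, `twistBy_s`, `twistBy_charW` (all `rfl`), `pairSplitting_twistBy_apply`,
the adèlic scalar law `pairRep_twistBy_apply` (`ω((p ⊗ ĉ).s_pair(g)) = ĉ(g_V g_W) · ω(p.s_pair(g))`, vendored `pairRep_twist_apply`),
and the orbit laws `twistBy_one`, `twistBy_twistBy` (generic `twist_one'`, `twist_twist'`).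
-/

noncomputable section

open Function Set
open NumberField
open Literature.NumberTheory.Automorphic
open Literature.NumberTheory.GelbartRogawski1991 Literature.NumberTheory.GelbartRogawski1991.UnitaryDualPair
open Literature.NumberTheory.Weil1964

namespace HodgeCM.Model

/-! ## §0. Two orbit laws of the splitting-level twist (generic) -/

section TwistLaws

variable {F : Type} [Field F] [NumberField F] {ι : Type} [Fintype ι] [DecidableEq ι]
  {T : Matrix ι ι (AdeleRing (𝓞 F) F)} {H : Type*} [Group H] (s : H →* adelicMpCont F ι T)

/-- the twist by the trivial character is the identity: `s ⊗ 1 = s`. [folklore] -/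
theorem adelicMpCont_twist_one : adelicMpCont.twist F ι T s 1 = s :=
  MonoidHom.ext fun h => adelicMpCont.twist_eq_of_eq_one s 1 (γ := h) rfl

set_option maxHeartbeats 800000 in
/-- twists compose: `(s ⊗ η₁) ⊗ η₂ = s ⊗ (η₁ η₂)` (term-mode chain, as the vendored file advises). [folklore] -/
theorem adelicMpCont_twist_twist (η₁ η₂ : H →* ℂˣ) :
    adelicMpCont.twist F ι T (adelicMpCont.twist F ι T s η₁) η₂ = adelicMpCont.twist F ι T s (η₁ * η₂) :=
  MonoidHom.ext fun h =>
    (adelicMpCont.twist_apply (adelicMpCont.twist F ι T s η₁) η₂ h).trans <|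
      (congrArg (adelicMpCont.ofScalar F ι T (η₂ h) * ·) (adelicMpCont.twist_apply s η₁ h)).trans <|
        (mul_assoc _ _ _).symm.trans <|
          (congrArg (· * s h) (map_mul (adelicMpCont.ofScalar F ι T) (η₂ h) (η₁ h)).symm).trans <|
            (congrArg (fun c : ℂˣ => adelicMpCont.ofScalar F ι T c * s h) (mul_comm (η₂ h) (η₁ h))).trans
              (adelicMpCont.twist_apply s (η₁ * η₂) h).symm

end TwistLaws

/-! ## §1. The cell: twisting the index record `SplitLine` -/

variable {L : CMField} {ι₁ : (L : Type) →+* ℂ} {V : HermSpace3 L ι₁}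
variable {JV : Matrix (Fin 3) (Fin 3) (L : Type)} {TV : Matrix (Fin 3) (Fin 3) ↥(maximalRealSubfield (L : Type))}
  {δ : (L : Type)} {hcδ : IsCMField.complexConj (L : Type) δ = -δ} {hδ : δ ≠ 0} {d : ↥(maximalRealSubfield (L : Type))}
  {hd : δ * δ = algebraMap _ (L : Type) d} {hV : TV.IsSymm} {hVd : IsUnit TV.det}
  {hJV : JV = TV.map (algebraMap _ (L : Type))}

namespace SplitLine

variable (p : SplitLine JV TV hcδ hδ hd hV hVd hJV)
  (ιV : ↥V.adelicFin →*
    ↥(UnitaryGroup.finAdelic (↥(maximalRealSubfield (L : Type))) (L : Type) (IsCMField.complexConj (L : Type)) 3 JV))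

/-- the characters of the big group `G₁(𝔸_{L⁺}) = U(J_V ⊗ J_W)(𝔸_{L⁺})` of the record `p` — the domain of its splitting `p.s`,
through which it may be twisted ([GelbartRogawski1991] §3.1 Remark p. 457). -/
abbrev BigChar : Type :=
  ↥(UnitaryGroup.adelicPair (↥(maximalRealSubfield (L : Type))) (L : Type) (IsCMField.complexConj (L : Type)) 3 1 JV p.JW) →* ℂˣ

/-- the rational points `G₁(L⁺) = U(J_V ⊗ J_W)(L⁺)` of the big group of the record `p`. -/
abbrev RatPair : Type :=
  ↥(UnitaryGroup.rationalPair (↥(maximalRealSubfield (L : Type))) (L : Type) (IsCMField.complexConj (L : Type)) 3 1 JV p.JW)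

/-- **the finite pair character** `ĉ_f : (k, u) ↦ ĉ(((1_∞, k) ⊗ 1) · (1 ⊗ (1_∞, u)))` of a big character `ĉ`, on
`U(J_V)(𝔸_f) × U(J_W)(𝔸_f)` (`ĉ ∘ pairMap ∘ finPairToAdelic`). [folklore] -/
def finPairCharOf (ĉ : p.BigChar) :
    ↥(UnitaryGroup.finAdelic (↥(maximalRealSubfield (L : Type))) (L : Type) (IsCMField.complexConj (L : Type)) 3 JV) ×
        ↥(UnitaryGroup.finAdelic (↥(maximalRealSubfield (L : Type))) (L : Type) (IsCMField.complexConj (L : Type)) 1 p.JW) →*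
      ℂˣ :=
  (ĉ.comp (pairMap (↥(maximalRealSubfield (L : Type))) (L : Type) (IsCMField.complexConj (L : Type)) 3 1 JV p.JW)).comp
    (HodgeCM.WeilCoinv.finPairToAdelic (↥(maximalRealSubfield (L : Type))) (L : Type) (IsCMField.complexConj (L : Type)) 3 1 JV
      p.JW)

/-- formula. [folklore] -/
theorem finPairCharOf_apply (ĉ : p.BigChar)
    (q : ↥(UnitaryGroup.finAdelic (↥(maximalRealSubfield (L : Type))) (L : Type) (IsCMField.complexConj (L : Type)) 3 JV) ×
      ↥(UnitaryGroup.finAdelic (↥(maximalRealSubfield (L : Type))) (L : Type) (IsCMField.complexConj (L : Type)) 1 p.JW)) :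
    p.finPairCharOf ĉ q =
      ĉ (pairMap (↥(maximalRealSubfield (L : Type))) (L : Type) (IsCMField.complexConj (L : Type)) 3 1 JV p.JW
        (HodgeCM.WeilCoinv.finPairToAdelic (↥(maximalRealSubfield (L : Type))) (L : Type) (IsCMField.complexConj (L : Type)) 3 1
          JV p.JW q)) := rfl

/-- «`ĉ` is TRIVIAL ON THE RATIONAL POINTS `G₁(L⁺)`» — the automorphy hypothesis under which `p.s ⊗ ĉ` stays compatible. -/
abbrev IsRatTrivial (ĉ : p.BigChar) : Prop :=
  ∀ γ₀ : p.RatPair,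
    ĉ (UnitaryGroup.rationalPairToAdelic (↥(maximalRealSubfield (L : Type))) (L : Type) (IsCMField.complexConj (L : Type)) 3 1
      JV p.JW γ₀) = 1

/-- the trivial character is rationally trivial. [folklore] -/
theorem IsRatTrivial.one : p.IsRatTrivial 1 := fun _ => rfl

variable {p} in
/-- rationally trivial characters are closed under products. [folklore] -/
theorem IsRatTrivial.mul {ĉ₁ ĉ₂ : p.BigChar} (h₁ : p.IsRatTrivial ĉ₁) (h₂ : p.IsRatTrivial ĉ₂) : p.IsRatTrivial (ĉ₁ * ĉ₂) :=
  fun γ₀ => by rw [MonoidHom.mul_apply, h₁ γ₀, h₂ γ₀, mul_one]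

/-- the rational-triviality hypothesis in the datum's form (`ratPts = G₁(L⁺)`, vendored `splittingDatum_ratPts`). [folklore] -/
theorem ratTrivial (ĉ : p.BigChar) (hĉ : p.IsRatTrivial ĉ) :
    ∀ γ ∈ (splittingDatum (↥(maximalRealSubfield (L : Type))) (L : Type) (IsCMField.complexConj (L : Type)) 3 1 p.e JV p.JW
      hcδ hδ hd hV p.hW hVd p.hWd hJV p.hJW).ratPts, ĉ γ = 1 := by
  intro γ hγ
  rw [splittingDatum_ratPts] at hγ
  obtain ⟨γ₀, rfl⟩ := hγ
  exact hĉ γ₀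

/-- **THE TWISTED INDEX RECORD `p ⊗ ĉ`**: the same hermitian line with the compatible pair splitting `p.s ⊗ ĉ`, for a character
`ĉ` of `G₁(𝔸_{L⁺})` TRIVIAL ON `G₁(L⁺)` ([GelbartRogawski1991] §3.1 Remark p. 457: every compatible splitting is of this form;
the compatibility of the twist is the vendored kernel theorem `UnitaryDualPair.isCompatible_twist`).
[cite: GelbartRogawski1991, §3.1 Remark p. 457 L4–13] -/
def twistBy (ĉ : p.BigChar) (hĉ : p.IsRatTrivial ĉ) : SplitLine JV TV hcδ hδ hd hV hVd hJV where
  toHermLineDatum := p.toHermLineDatum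
  s := adelicMpCont.twist (↥(maximalRealSubfield (L : Type))) (Fin p.n)
    (adelicGram (↥(maximalRealSubfield (L : Type))) p.e TV p.TW) p.s ĉ
  hs := isCompatible_twist (↥(maximalRealSubfield (L : Type))) (L : Type) (IsCMField.complexConj (L : Type)) 3 1 p.e JV p.JW
    hcδ hδ hd hV p.hW hVd p.hWd hJV p.hJW p.hs (p.ratTrivial ĉ hĉ)

/-- (Ported verbatim from the HodgeCMPerL package; no docstring in the source.) -/
@[simp] theorem twistBy_toHermLineDatum (ĉ : p.BigChar) (hĉ : p.IsRatTrivial ĉ) :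
    (p.twistBy ĉ hĉ).toHermLineDatum = p.toHermLineDatum := rfl

/-- same line. -/
theorem twistBy_JW (ĉ : p.BigChar) (hĉ : p.IsRatTrivial ĉ) : (p.twistBy ĉ hĉ).JW = p.JW := rfl

/-- the splitting of the twisted record is `p.s ⊗ ĉ`. -/
theorem twistBy_s (ĉ : p.BigChar) (hĉ : p.IsRatTrivial ĉ) :
    (p.twistBy ĉ hĉ).s =
      adelicMpCont.twist (↥(maximalRealSubfield (L : Type))) (Fin p.n)
        (adelicGram (↥(maximalRealSubfield (L : Type))) p.e TV p.TW) p.s ĉ := rfl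

/-- on the pair `U(J_V)(𝔸) × U(J_W)(𝔸)`: `(p ⊗ ĉ).s_pair(g) = (1, ĉ(g_V · g_W)) · p.s_pair(g)` (vendored `pairSplitting_twist_apply`).
[folklore] -/
theorem pairSplitting_twistBy_apply (ĉ : p.BigChar) (hĉ : p.IsRatTrivial ĉ)
    (g : ↥(UnitaryGroup.adelic (↥(maximalRealSubfield (L : Type))) (L : Type) (IsCMField.complexConj (L : Type)) 3 JV) ×
      ↥(UnitaryGroup.adelic (↥(maximalRealSubfield (L : Type))) (L : Type) (IsCMField.complexConj (L : Type)) 1 p.JW)) :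
    pairSplitting (↥(maximalRealSubfield (L : Type))) (L : Type) (IsCMField.complexConj (L : Type)) 3 1 p.e JV p.JW
        (p.twistBy ĉ hĉ).s g =
      adelicMpCont.ofScalar (↥(maximalRealSubfield (L : Type))) (Fin p.n)
          (adelicGram (↥(maximalRealSubfield (L : Type))) p.e TV p.TW)
          (ĉ (pairMap (↥(maximalRealSubfield (L : Type))) (L : Type) (IsCMField.complexConj (L : Type)) 3 1 JV p.JW g)) *
        pairSplitting (↥(maximalRealSubfield (L : Type))) (L : Type) (IsCMField.complexConj (L : Type)) 3 1 p.e JV p.JW p.s g :=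
  pairSplitting_twist_apply (↥(maximalRealSubfield (L : Type))) (L : Type) (IsCMField.complexConj (L : Type)) 3 1 p.e JV p.JW p.s
    ĉ g

/-- the characters of `U(W)(𝔸_f)` do not change under the twist (same line), so neither does the shape of `Ω`. -/
theorem twistBy_charW (ĉ : p.BigChar) (hĉ : p.IsRatTrivial ĉ) : (p.twistBy ĉ hĉ).CharW = p.CharW := rfl

set_option maxHeartbeats 800000 in
/-- **the adèlic scalar law of the twisted record**: `ω((p ⊗ ĉ).s_pair(g)) Φ = ĉ(g_V · g_W) • ω(p.s_pair(g)) Φ` on the pair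
`U(J_V)(𝔸) × U(J_W)(𝔸)` (vendored `UnitaryDualPair.pairRep_twist_apply`). [cite: GelbartRogawski1991, §3.1 Remark p. 457 L4–13] -/
theorem pairRep_twistBy_apply (ĉ : p.BigChar) (hĉ : p.IsRatTrivial ĉ)
    (g : ↥(UnitaryGroup.adelic (↥(maximalRealSubfield (L : Type))) (L : Type) (IsCMField.complexConj (L : Type)) 3 JV) ×
      ↥(UnitaryGroup.adelic (↥(maximalRealSubfield (L : Type))) (L : Type) (IsCMField.complexConj (L : Type)) 1 p.JW))
    (Φ : piSchwartzBruhat (↥(maximalRealSubfield (L : Type))) (Fin p.n)) :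
    pairRep (↥(maximalRealSubfield (L : Type))) (L : Type) (IsCMField.complexConj (L : Type)) 3 1 p.e JV p.JW (p.twistBy ĉ hĉ).s g
        Φ =
      ((ĉ (pairMap (↥(maximalRealSubfield (L : Type))) (L : Type) (IsCMField.complexConj (L : Type)) 3 1 JV p.JW g) : ℂˣ) : ℂ) •
        pairRep (↥(maximalRealSubfield (L : Type))) (L : Type) (IsCMField.complexConj (L : Type)) 3 1 p.e JV p.JW p.s g Φ :=
  pairRep_twist_apply (↥(maximalRealSubfield (L : Type))) (L : Type) (IsCMField.complexConj (L : Type)) 3 1 p.e JV p.JW p.s ĉ g Φ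

/-- **orbit law 1**: twisting by the trivial character returns the record. [folklore] -/
theorem twistBy_one (h : p.IsRatTrivial 1) : p.twistBy 1 h = p := by
  cases p with
  | mk ℓ s hs =>
    simp only [twistBy]
    congr 1
    exact adelicMpCont_twist_one s

/-- **orbit law 2**: two twists compose to the twist by the product ([GelbartRogawski1991] Remark p. 457: the compatible
splittings are a torsor under the rationally trivial characters). [folklore] -/
theorem twistBy_twistBy (ĉ₁ : p.BigChar) (h₁ : p.IsRatTrivial ĉ₁) (ĉ₂ : p.BigChar) (h₂ : p.IsRatTrivial ĉ₂) :
    (p.twistBy ĉ₁ h₁).twistBy ĉ₂ h₂ = p.twistBy (ĉ₁ * ĉ₂) (h₁.mul h₂) := by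
  cases p with
  | mk ℓ s hs =>
    simp only [twistBy]
    congr 1
    exact adelicMpCont_twist_twist s ĉ₁ ĉ₂

/-- plumbing check: the twisted record indexes carriers of the SAME dictionary shape (`Ω` of #4 applies verbatim). -/
example (ĉ : p.BigChar) (hĉ : p.IsRatTrivial ĉ) (χ : p.CharW) : Module (adelicAlgebra V) ((p.twistBy ĉ hĉ).Ω ιV χ) :=
  inferInstance


end SplitLine

end HodgeCM.Model

end
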